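import Mathlib
import Summits.PneNP.PneNP.Theorems.CnfIdealGenLengthRankDefectRepresentationsQuadrantCapture
import Summits.PneNP.PneNP.Theorems.CnfIdealGenLengthRankDefectRepresentationsMergeReduction

/-!
# Crux `RankDefectRepresentations` (stmt-PneNP-18923), line `rank-dehn-ladder`: the 2D MAX-CUT DECOMPOSITION WITH THE ABSOLUTE CONSTANT 4
# (lead g16, RESHAPE 16; memo `Cruxes/RankDefectRepresentations/Lines/rank-dehn-ladder-g16.md` §7)

THE SHARP TWO-FAMILY AVERAGE-CUT THEOREM.  For a two-family instance `D` (rows/columns coloured by `{0,1}^n × {0,1}^{n'}`, a cell visible iff both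
families' colours differ, `Φ(A,A') = doubleCut row col A A' D` = the sum of the four rectangle ranks):

    `mc(D) ≤ 4 · E_{A,A'} Φ(A,A')`,   hence   `DoubleMaxCutDecomposition K n n' 4`  (every `Φ ≤ c` ⟹ `D = S_I + S_J + L`, `rank L ≤ 4c`).

This is the registered tool stub `stub_doubleMaxCutDecomposition` with the ABSOLUTE constant `λ = 4` (leads g9–g15 asked for a polynomial in the number of
coordinates and reduced it to MERGE / CORE-LINEAR / adjacent splitting), and it closes the registered `stub_merge` (`merge_four`, via
`…MergeReduction.merge_of_doubleMaxCut`).  The constant 4 is sharp (a single off-diagonal block; every weak staircase, memo §3).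

PROOF (one shot, no recursion).  Fix a double cut `(A,A')`.  Each of the four ROW BANDS (`(cI ∈ A) = s`, `(cJ ∈ A') = t`) is completed through ITS rectangle
(the band's rows against the antipodal column band): every other column group of the band — a first-family strip, a second-family strip, or a class pair — is
written as a combination of the rectangle's columns (and, for pairs, of the two strips) on its VISIBLE rows and extrapolated to its invisible rows; the error of a
group is exactly its private dimension inside a rectangle at a SHIFTED cut (`(A∖i,A')`, `(A,A'∖j)`, `(A∖i,A'∖j)`) — registered stub X1 `stub_bandCompletion`
(hypothesis `hBC`).  Summed over all cuts, re-indexing `A ↦ A∖i` turns each error family into "sum over cuts of the private dimensions of the column classes of the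
rectangle", which is at most the sum of the rectangle ranks — registered stub X2 `stub_bandAveraging` (hypothesis `hBA`).  So `Σ_{cuts} cost ≤ Σ (Φ + 3Φ) = 4 Σ Φ ≤
4c · #cuts`, and the cheapest cut has cost `≤ 4c`.  This file is the ASSEMBLY, conditional on the two registered TRUE stubs (numerically verified over `F₂`,
`compute/bandcheck`: the construction was built explicitly on > 1 000 bands with zero violations); `doubleMaxCut_four_of_stubs` becomes unconditional when they land.
HONEST FRAMING: negative-lane tool (SIM becomes polynomially rank-stable once the stubs land); the item (RDR) stays open; P ≠ NP is not moved; F-N2 is a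
FRONTIER formal rung.
-/

set_option linter.dupNamespace false -- `Summit.PneNP.PneNP.…`: summit = sub-problem name (D-0017)

namespace Summit.PneNP.PneNP.Theorems.CnfIdealGenLengthRankDefectRepresentationsDoubleMaxCutFour

open Matrix Finset
open Summit.PneNP.PneNP.Theorems.CnfIdealGenLengthRankDefectRepresentationsMergeLowerBound (rank_add_le')
open Summit.PneNP.PneNP.Theorems.CnfIdealGenLengthRankDefectRepresentationsTwoFamilyCutDomination (colourI colourJ doubleCut DoubleMaxCutDecomposition)
open Summit.PneNP.PneNP.Theorems.CnfIdealGenLengthRankDefectRepresentationsQuadrantCapture (rect rect_apply doubleCut_eq_sum_four)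
open Summit.PneNP.PneNP.Theorems.CnfIdealGenLengthRankDefectRepresentationsMergeReduction (MergeBound merge_of_doubleMaxCut)

variable {K : Type} [Field K]

/-! ## The two registered stubs as named hypotheses (generic two-colouring form) -/

section Generic

variable {ι ι' X Y : Type} [Fintype ι] [Fintype ι'] [DecidableEq ι] [DecidableEq ι'] [DecidableEq X] [DecidableEq Y]
variable (rI : ι → X) (rJ : ι → Y) (cI : ι' → X) (cJ : ι' → Y) (D : Matrix ι ι' K)

/-- The (zero-padded) RECTANGLE of the double cut `(A,A')`: rows `rI ∈ A ∧ rJ ∈ A'`, columns `cI ∉ A ∧ cJ ∉ A'`. -/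
def Rm (A : Finset X) (A' : Finset Y) : Matrix ι ι' K :=
  Matrix.of fun x y => if (rI x ∈ A ∧ rJ x ∈ A') ∧ (cI y ∉ A ∧ cJ y ∉ A') then D x y else 0

/-- The three ERROR families of the band completion at `(A,A')` (private dimensions at shifted cuts), as one integer. -/
noncomputable def err (A : Finset X) (A' : Finset Y) : ℤ :=
  ∑ i ∈ A,
      (((Matrix.of fun x y => if (rI x ∈ A.erase i ∧ rJ x ∈ A') ∧ (cI y ∉ A.erase i ∧ cJ y ∉ A') then D x y else 0).rank : ℤ) -
       ((Matrix.of fun x y => if (rI x ∈ A.erase i ∧ rJ x ∈ A') ∧ (cI y ∉ A ∧ cJ y ∉ A') then D x y else 0).rank : ℤ)) +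
    ∑ j ∈ A',
      (((Matrix.of fun x y => if (rI x ∈ A ∧ rJ x ∈ A'.erase j) ∧ (cI y ∉ A ∧ cJ y ∉ A'.erase j) then D x y else 0).rank : ℤ) -
       ((Matrix.of fun x y => if (rI x ∈ A ∧ rJ x ∈ A'.erase j) ∧ (cI y ∉ A ∧ cJ y ∉ A') then D x y else 0).rank : ℤ)) +
    ∑ i ∈ A, ∑ j ∈ A',
      (((Matrix.of fun x y => if (rI x ∈ A.erase i ∧ rJ x ∈ A'.erase j) ∧ (cI y ∉ A.erase i ∧ cJ y ∉ A'.erase j)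
          then D x y else 0).rank : ℤ) -
       ((Matrix.of fun x y => if (rI x ∈ A.erase i ∧ rJ x ∈ A'.erase j) ∧ (cI y ∉ A.erase i ∧ cJ y ∉ A'.erase j) ∧
            ¬ (cI y = i ∧ cJ y = j) then D x y else 0).rank : ℤ))

/- The two registered stubs enter as HYPOTHESES `hBC` (X1, `stub_bandCompletion`, verbatim) and `hBA` (X2, `stub_bandAveraging`, verbatim);
`…DoubleMaxCutFourAssembly` instantiates them once they land. -/
variable (hBC : ∀ (K : Type) [Field K] (ι ι' X Y : Type) [Fintype ι] [Fintype ι'] [DecidableEq ι] [DecidableEq ι'] [DecidableEq X] [DecidableEq Y]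
    (rI : ι → X) (rJ : ι → Y) (cI : ι' → X) (cJ : ι' → Y) (D : Matrix ι ι' K) (A : Finset X) (A' : Finset Y),
    ∃ L : Matrix ι ι' K,
      (∀ x y, ¬ (rI x ∈ A ∧ rJ x ∈ A') → L x y = 0) ∧
      (∀ x y, rI x ∈ A → rJ x ∈ A' → rI x ≠ cI y → rJ x ≠ cJ y → L x y = D x y) ∧
      (L.rank : ℤ) ≤
        ((Matrix.of fun x y => if (rI x ∈ A ∧ rJ x ∈ A') ∧ (cI y ∉ A ∧ cJ y ∉ A') then D x y else 0).rank : ℤ) +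
        ∑ i ∈ A,
          (((Matrix.of fun x y => if (rI x ∈ A.erase i ∧ rJ x ∈ A') ∧ (cI y ∉ A.erase i ∧ cJ y ∉ A') then D x y else 0).rank : ℤ) -
           ((Matrix.of fun x y => if (rI x ∈ A.erase i ∧ rJ x ∈ A') ∧ (cI y ∉ A ∧ cJ y ∉ A') then D x y else 0).rank : ℤ)) +
        ∑ j ∈ A',
          (((Matrix.of fun x y => if (rI x ∈ A ∧ rJ x ∈ A'.erase j) ∧ (cI y ∉ A ∧ cJ y ∉ A'.erase j) then D x y else 0).rank : ℤ) -
           ((Matrix.of fun x y => if (rI x ∈ A ∧ rJ x ∈ A'.erase j) ∧ (cI y ∉ A ∧ cJ y ∉ A') then D x y else 0).rank : ℤ)) +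
        ∑ i ∈ A, ∑ j ∈ A',
          (((Matrix.of fun x y => if (rI x ∈ A.erase i ∧ rJ x ∈ A'.erase j) ∧ (cI y ∉ A.erase i ∧ cJ y ∉ A'.erase j)
              then D x y else 0).rank : ℤ) -
           ((Matrix.of fun x y => if (rI x ∈ A.erase i ∧ rJ x ∈ A'.erase j) ∧ (cI y ∉ A.erase i ∧ cJ y ∉ A'.erase j) ∧
                ¬ (cI y = i ∧ cJ y = j) then D x y else 0).rank : ℤ)))
variable (hBA : ∀ (K : Type) [Field K] (ι ι' X Y : Type) [Fintype ι] [Fintype ι'] [DecidableEq ι] [DecidableEq ι'] [Fintype X] [DecidableEq X]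
    [Fintype Y] [DecidableEq Y] (rI : ι → X) (rJ : ι → Y) (cI : ι' → X) (cJ : ι' → Y) (D : Matrix ι ι' K),
    ∑ A : Finset X, ∑ A' : Finset Y,
      (∑ i ∈ A,
          (((Matrix.of fun x y => if (rI x ∈ A.erase i ∧ rJ x ∈ A') ∧ (cI y ∉ A.erase i ∧ cJ y ∉ A') then D x y else 0).rank : ℤ) -
           ((Matrix.of fun x y => if (rI x ∈ A.erase i ∧ rJ x ∈ A') ∧ (cI y ∉ A ∧ cJ y ∉ A') then D x y else 0).rank : ℤ)) +
        ∑ j ∈ A',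
          (((Matrix.of fun x y => if (rI x ∈ A ∧ rJ x ∈ A'.erase j) ∧ (cI y ∉ A ∧ cJ y ∉ A'.erase j) then D x y else 0).rank : ℤ) -
           ((Matrix.of fun x y => if (rI x ∈ A ∧ rJ x ∈ A'.erase j) ∧ (cI y ∉ A ∧ cJ y ∉ A') then D x y else 0).rank : ℤ)) +
        ∑ i ∈ A, ∑ j ∈ A',
          (((Matrix.of fun x y => if (rI x ∈ A.erase i ∧ rJ x ∈ A'.erase j) ∧ (cI y ∉ A.erase i ∧ cJ y ∉ A'.erase j)
              then D x y else 0).rank : ℤ) -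
           ((Matrix.of fun x y => if (rI x ∈ A.erase i ∧ rJ x ∈ A'.erase j) ∧ (cI y ∉ A.erase i ∧ cJ y ∉ A'.erase j) ∧
                ¬ (cI y = i ∧ cJ y = j) then D x y else 0).rank : ℤ))) ≤
      3 * ∑ A : Finset X, ∑ A' : Finset Y,
        ((Matrix.of fun x y => if (rI x ∈ A ∧ rJ x ∈ A') ∧ (cI y ∉ A ∧ cJ y ∉ A') then D x y else 0).rank : ℤ))

include hBC in
/-- Unfolding: band completion gives, at every cut, a band matrix of rank `≤ rank Rm + err`. -/
theorem bandCompletion_err (A : Finset X) (A' : Finset Y) :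
    ∃ L : Matrix ι ι' K,
      (∀ x y, ¬ (rI x ∈ A ∧ rJ x ∈ A') → L x y = 0) ∧
      (∀ x y, rI x ∈ A → rJ x ∈ A' → rI x ≠ cI y → rJ x ≠ cJ y → L x y = D x y) ∧
      (L.rank : ℤ) ≤ ((Rm rI rJ cI cJ D A A').rank : ℤ) + err rI rJ cI cJ D A A' := by
  obtain ⟨L, h1, h2, h3⟩ := hBC K ι ι' X Y rI rJ cI cJ D A A'
  refine ⟨L, h1, h2, ?_⟩
  simpa only [Rm, err, add_assoc] using h3

include hBA in
/-- Unfolding: the error families sum, over all cuts, to at most three times the rectangle ranks. -/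
theorem bandAveraging_err [Fintype X] [Fintype Y] :
    ∑ A : Finset X, ∑ A' : Finset Y, err rI rJ cI cJ D A A' ≤
      3 * ∑ A : Finset X, ∑ A' : Finset Y, ((Rm rI rJ cI cJ D A A').rank : ℤ) := by
  simpa only [Rm, err] using hBA K ι ι' X Y rI rJ cI cJ D

/-! ## Four bands at one cut -/

variable [Fintype X] [Fintype Y]

/-- The COST of the double cut `(A,A')`: the four rectangle ranks plus the four bands' error terms (band `(s,t)` of `(A,A')` is band `(true,true)`
of the cut obtained by complementing `A` when `s = false` and `A'` when `t = false`). -/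
noncomputable def cost (A : Finset X) (A' : Finset Y) : ℤ :=
  (((Rm rI rJ cI cJ D A A').rank : ℤ) + err rI rJ cI cJ D A A') +
  (((Rm rI rJ cI cJ D A A'ᶜ).rank : ℤ) + err rI rJ cI cJ D A A'ᶜ) +
  (((Rm rI rJ cI cJ D Aᶜ A').rank : ℤ) + err rI rJ cI cJ D Aᶜ A') +
  (((Rm rI rJ cI cJ D Aᶜ A'ᶜ).rank : ℤ) + err rI rJ cI cJ D Aᶜ A'ᶜ)

include hBC in
/-- **Four bands.**  Given band completion, at every double cut one matrix agrees with `D` on ALL visible cells and has rank `≤ cost(A,A')`. -/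
theorem exists_completion_cost (A : Finset X) (A' : Finset Y) :
    ∃ L : Matrix ι ι' K, (∀ x y, rI x ≠ cI y → rJ x ≠ cJ y → L x y = D x y) ∧
      (L.rank : ℤ) ≤ cost rI rJ cI cJ D A A' := by
  classical
  obtain ⟨L₁, s₁, a₁, r₁⟩ := bandCompletion_err rI rJ cI cJ D hBC A A'
  obtain ⟨L₂, s₂, a₂, r₂⟩ := bandCompletion_err rI rJ cI cJ D hBC A A'ᶜ
  obtain ⟨L₃, s₃, a₃, r₃⟩ := bandCompletion_err rI rJ cI cJ D hBC Aᶜ A'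
  obtain ⟨L₄, s₄, a₄, r₄⟩ := bandCompletion_err rI rJ cI cJ D hBC Aᶜ A'ᶜ
  refine ⟨L₁ + L₂ + L₃ + L₄, ?_, ?_⟩
  · intro x y hI hJ
    simp only [Matrix.add_apply]
    by_cases hA : rI x ∈ A <;> by_cases hA' : rJ x ∈ A'
    · rw [a₁ x y hA hA' hI hJ, s₂ x y (fun h => absurd hA' (Finset.mem_compl.mp h.2)),
        s₃ x y (fun h => absurd hA (Finset.mem_compl.mp h.1)), s₄ x y (fun h => absurd hA (Finset.mem_compl.mp h.1))]
      ring
    · rw [s₁ x y (fun h => hA' h.2), a₂ x y hA (Finset.mem_compl.mpr hA') hI hJ,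
        s₃ x y (fun h => absurd hA (Finset.mem_compl.mp h.1)), s₄ x y (fun h => absurd hA (Finset.mem_compl.mp h.1))]
      ring
    · rw [s₁ x y (fun h => hA h.1), s₂ x y (fun h => hA h.1), a₃ x y (Finset.mem_compl.mpr hA) hA' hI hJ,
        s₄ x y (fun h => absurd hA' (Finset.mem_compl.mp h.2))]
      ring
    · rw [s₁ x y (fun h => hA h.1), s₂ x y (fun h => hA h.1), s₃ x y (fun h => hA' h.2),
        a₄ x y (Finset.mem_compl.mpr hA) (Finset.mem_compl.mpr hA') hI hJ]
      ring
  · have e := rank_add_le' (L₁ + L₂ + L₃) L₄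
    have e' := rank_add_le' (L₁ + L₂) L₃
    have e'' := rank_add_le' L₁ L₂
    have : ((L₁ + L₂ + L₃ + L₄).rank : ℤ) ≤ (L₁.rank : ℤ) + L₂.rank + L₃.rank + L₄.rank := by
      have := e.trans (Nat.add_le_add_right (e'.trans (Nat.add_le_add_right e'' _)) _)
      exact_mod_cast this
    unfold cost
    linarith

/-! ## Averaging over all cuts -/

omit [DecidableEq X] in
/-- Complementing the second cut is a bijection: sums over `A'` are invariant. -/
theorem sum_compl_right (f : Finset X → Finset Y → ℤ) :
    ∑ A : Finset X, ∑ A' : Finset Y, f A A'ᶜ = ∑ A : Finset X, ∑ A' : Finset Y, f A A' := by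
  refine Finset.sum_congr rfl fun A _ => ?_
  exact Fintype.sum_equiv ⟨fun A' => A'ᶜ, fun A' => A'ᶜ, fun A' => compl_compl A', fun A' => compl_compl A'⟩ _ _ (fun _ => rfl)

omit [DecidableEq Y] in
/-- Complementing the first cut is a bijection: sums over `A` are invariant. -/
theorem sum_compl_left (f : Finset X → Finset Y → ℤ) :
    ∑ A : Finset X, ∑ A' : Finset Y, f Aᶜ A' = ∑ A : Finset X, ∑ A' : Finset Y, f A A' :=
  Fintype.sum_equiv ⟨fun A => Aᶜ, fun A => Aᶜ, fun A => compl_compl A, fun A => compl_compl A⟩ _ _ (fun _ => rfl)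

include hBA in
/-- **The total cost is at most four times the total double cut** (band averaging for each of the four band types). -/
theorem sum_cost_le :
    ∑ A : Finset X, ∑ A' : Finset Y, cost rI rJ cI cJ D A A' ≤
      4 * ∑ A : Finset X, ∑ A' : Finset Y,
        (((Rm rI rJ cI cJ D A A').rank : ℤ) + ((Rm rI rJ cI cJ D A A'ᶜ).rank : ℤ) +
          ((Rm rI rJ cI cJ D Aᶜ A').rank : ℤ) + ((Rm rI rJ cI cJ D Aᶜ A'ᶜ).rank : ℤ)) := by
  have h0 := bandAveraging_err rI rJ cI cJ D hBA
  -- the four (rank, err) families, each re-indexed to the standard one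
  set S : ℤ := ∑ A : Finset X, ∑ A' : Finset Y, ((Rm rI rJ cI cJ D A A').rank : ℤ) with hS
  set E : ℤ := ∑ A : Finset X, ∑ A' : Finset Y, err rI rJ cI cJ D A A' with hE
  have hE3 : E ≤ 3 * S := h0
  have e1 : ∑ A : Finset X, ∑ A' : Finset Y, ((Rm rI rJ cI cJ D A A'ᶜ).rank : ℤ) = S :=
    sum_compl_right (fun A A' => ((Rm rI rJ cI cJ D A A').rank : ℤ))
  have e2 : ∑ A : Finset X, ∑ A' : Finset Y, ((Rm rI rJ cI cJ D Aᶜ A').rank : ℤ) = S :=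
    sum_compl_left (fun A A' => ((Rm rI rJ cI cJ D A A').rank : ℤ))
  have e3 : ∑ A : Finset X, ∑ A' : Finset Y, ((Rm rI rJ cI cJ D Aᶜ A'ᶜ).rank : ℤ) = S := by
    rw [sum_compl_left (fun A A' => ((Rm rI rJ cI cJ D A A'ᶜ).rank : ℤ))]; exact e1
  have f1 : ∑ A : Finset X, ∑ A' : Finset Y, err rI rJ cI cJ D A A'ᶜ = E :=
    sum_compl_right (fun A A' => err rI rJ cI cJ D A A')
  have f2 : ∑ A : Finset X, ∑ A' : Finset Y, err rI rJ cI cJ D Aᶜ A' = E :=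
    sum_compl_left (fun A A' => err rI rJ cI cJ D A A')
  have f3 : ∑ A : Finset X, ∑ A' : Finset Y, err rI rJ cI cJ D Aᶜ A'ᶜ = E := by
    rw [sum_compl_left (fun A A' => err rI rJ cI cJ D A A'ᶜ)]; exact f1
  have lhs : ∑ A : Finset X, ∑ A' : Finset Y, cost rI rJ cI cJ D A A' = 4 * S + 4 * E := by
    simp only [cost, Finset.sum_add_distrib]
    rw [e1, e2, e3, f1, f2, f3]; ring
  have rhs : ∑ A : Finset X, ∑ A' : Finset Y,
      (((Rm rI rJ cI cJ D A A').rank : ℤ) + ((Rm rI rJ cI cJ D A A'ᶜ).rank : ℤ) +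
        ((Rm rI rJ cI cJ D Aᶜ A').rank : ℤ) + ((Rm rI rJ cI cJ D Aᶜ A'ᶜ).rank : ℤ)) = 4 * S := by
    simp only [Finset.sum_add_distrib]
    rw [e1, e2, e3]; ring
  rw [lhs, rhs]
  linarith

include hBC hBA in
/-- **The cheapest cut.**  If every double cut has four-rectangle rank `≤ c`, some cut has cost `≤ 4c`, hence a completion of rank `≤ 4c`. -/
theorem exists_completion_le (c : ℕ)
    (hc : ∀ A A', (Rm rI rJ cI cJ D A A').rank + (Rm rI rJ cI cJ D A A'ᶜ).rank +
      ((Rm rI rJ cI cJ D Aᶜ A').rank + (Rm rI rJ cI cJ D Aᶜ A'ᶜ).rank) ≤ c) :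
    ∃ L : Matrix ι ι' K, (∀ x y, rI x ≠ cI y → rJ x ≠ cJ y → L x y = D x y) ∧ L.rank ≤ 4 * c := by
  classical
  have hsum := sum_cost_le rI rJ cI cJ D hBA
  have hbound : ∑ A : Finset X, ∑ A' : Finset Y,
      (((Rm rI rJ cI cJ D A A').rank : ℤ) + ((Rm rI rJ cI cJ D A A'ᶜ).rank : ℤ) +
        ((Rm rI rJ cI cJ D Aᶜ A').rank : ℤ) + ((Rm rI rJ cI cJ D Aᶜ A'ᶜ).rank : ℤ)) ≤
      ∑ A : Finset X, ∑ A' : Finset Y, (c : ℤ) := by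
    refine Finset.sum_le_sum fun A _ => Finset.sum_le_sum fun A' _ => ?_
    have := hc A A'
    linarith [(by exact_mod_cast this : ((Rm rI rJ cI cJ D A A').rank : ℤ) + (Rm rI rJ cI cJ D A A'ᶜ).rank +
      ((Rm rI rJ cI cJ D Aᶜ A').rank + (Rm rI rJ cI cJ D Aᶜ A'ᶜ).rank) ≤ c)]
  -- pass to the product index set and pick a minimiser
  have htot : ∑ p ∈ (Finset.univ : Finset (Finset X × Finset Y)), cost rI rJ cI cJ D p.1 p.2 ≤
      ∑ p ∈ (Finset.univ : Finset (Finset X × Finset Y)), (4 * (c : ℤ)) := by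
    rw [← Finset.univ_product_univ, Finset.sum_product, Finset.sum_product]
    calc ∑ A : Finset X, ∑ A' : Finset Y, cost rI rJ cI cJ D A A'
        ≤ 4 * ∑ A : Finset X, ∑ A' : Finset Y,
            (((Rm rI rJ cI cJ D A A').rank : ℤ) + ((Rm rI rJ cI cJ D A A'ᶜ).rank : ℤ) +
              ((Rm rI rJ cI cJ D Aᶜ A').rank : ℤ) + ((Rm rI rJ cI cJ D Aᶜ A'ᶜ).rank : ℤ)) := hsum
      _ ≤ 4 * ∑ A : Finset X, ∑ A' : Finset Y, (c : ℤ) := by linarith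
      _ = ∑ A : Finset X, ∑ A' : Finset Y, (4 * (c : ℤ)) := by simp only [Finset.sum_const, Finset.card_univ]; ring
  obtain ⟨p, -, hp⟩ := Finset.exists_le_of_sum_le (Finset.univ_nonempty) htot
  obtain ⟨L, hL, hr⟩ := exists_completion_cost rI rJ cI cJ D hBC p.1 p.2
  refine ⟨L, hL, ?_⟩
  have : (L.rank : ℤ) ≤ 4 * (c : ℤ) := hr.trans hp
  exact_mod_cast this

end Generic

/-! ## The registered decomposition with the constant 4 -/

section TwoFamily

variable {n n' : ℕ} {ι ι' : Type} [Fintype ι] [Fintype ι'] [DecidableEq ι] [DecidableEq ι']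
variable (row : ι → Fin n ⊕ Fin n' → Bool) (col : ι' → Fin n ⊕ Fin n' → Bool)
variable (hBC : ∀ (K : Type) [Field K] (ι ι' X Y : Type) [Fintype ι] [Fintype ι'] [DecidableEq ι] [DecidableEq ι'] [DecidableEq X] [DecidableEq Y]
    (rI : ι → X) (rJ : ι → Y) (cI : ι' → X) (cJ : ι' → Y) (D : Matrix ι ι' K) (A : Finset X) (A' : Finset Y),
    ∃ L : Matrix ι ι' K,
      (∀ x y, ¬ (rI x ∈ A ∧ rJ x ∈ A') → L x y = 0) ∧
      (∀ x y, rI x ∈ A → rJ x ∈ A' → rI x ≠ cI y → rJ x ≠ cJ y → L x y = D x y) ∧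
      (L.rank : ℤ) ≤
        ((Matrix.of fun x y => if (rI x ∈ A ∧ rJ x ∈ A') ∧ (cI y ∉ A ∧ cJ y ∉ A') then D x y else 0).rank : ℤ) +
        ∑ i ∈ A,
          (((Matrix.of fun x y => if (rI x ∈ A.erase i ∧ rJ x ∈ A') ∧ (cI y ∉ A.erase i ∧ cJ y ∉ A') then D x y else 0).rank : ℤ) -
           ((Matrix.of fun x y => if (rI x ∈ A.erase i ∧ rJ x ∈ A') ∧ (cI y ∉ A ∧ cJ y ∉ A') then D x y else 0).rank : ℤ)) +
        ∑ j ∈ A',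
          (((Matrix.of fun x y => if (rI x ∈ A ∧ rJ x ∈ A'.erase j) ∧ (cI y ∉ A ∧ cJ y ∉ A'.erase j) then D x y else 0).rank : ℤ) -
           ((Matrix.of fun x y => if (rI x ∈ A ∧ rJ x ∈ A'.erase j) ∧ (cI y ∉ A ∧ cJ y ∉ A') then D x y else 0).rank : ℤ)) +
        ∑ i ∈ A, ∑ j ∈ A',
          (((Matrix.of fun x y => if (rI x ∈ A.erase i ∧ rJ x ∈ A'.erase j) ∧ (cI y ∉ A.erase i ∧ cJ y ∉ A'.erase j)
              then D x y else 0).rank : ℤ) -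
           ((Matrix.of fun x y => if (rI x ∈ A.erase i ∧ rJ x ∈ A'.erase j) ∧ (cI y ∉ A.erase i ∧ cJ y ∉ A'.erase j) ∧
                ¬ (cI y = i ∧ cJ y = j) then D x y else 0).rank : ℤ)))
variable (hBA : ∀ (K : Type) [Field K] (ι ι' X Y : Type) [Fintype ι] [Fintype ι'] [DecidableEq ι] [DecidableEq ι'] [Fintype X] [DecidableEq X]
    [Fintype Y] [DecidableEq Y] (rI : ι → X) (rJ : ι → Y) (cI : ι' → X) (cJ : ι' → Y) (D : Matrix ι ι' K),
    ∑ A : Finset X, ∑ A' : Finset Y,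
      (∑ i ∈ A,
          (((Matrix.of fun x y => if (rI x ∈ A.erase i ∧ rJ x ∈ A') ∧ (cI y ∉ A.erase i ∧ cJ y ∉ A') then D x y else 0).rank : ℤ) -
           ((Matrix.of fun x y => if (rI x ∈ A.erase i ∧ rJ x ∈ A') ∧ (cI y ∉ A ∧ cJ y ∉ A') then D x y else 0).rank : ℤ)) +
        ∑ j ∈ A',
          (((Matrix.of fun x y => if (rI x ∈ A ∧ rJ x ∈ A'.erase j) ∧ (cI y ∉ A ∧ cJ y ∉ A'.erase j) then D x y else 0).rank : ℤ) -
           ((Matrix.of fun x y => if (rI x ∈ A ∧ rJ x ∈ A'.erase j) ∧ (cI y ∉ A ∧ cJ y ∉ A') then D x y else 0).rank : ℤ)) +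
        ∑ i ∈ A, ∑ j ∈ A',
          (((Matrix.of fun x y => if (rI x ∈ A.erase i ∧ rJ x ∈ A'.erase j) ∧ (cI y ∉ A.erase i ∧ cJ y ∉ A'.erase j)
              then D x y else 0).rank : ℤ) -
           ((Matrix.of fun x y => if (rI x ∈ A.erase i ∧ rJ x ∈ A'.erase j) ∧ (cI y ∉ A.erase i ∧ cJ y ∉ A'.erase j) ∧
                ¬ (cI y = i ∧ cJ y = j) then D x y else 0).rank : ℤ))) ≤
      3 * ∑ A : Finset X, ∑ A' : Finset Y,
        ((Matrix.of fun x y => if (rI x ∈ A ∧ rJ x ∈ A') ∧ (cI y ∉ A ∧ cJ y ∉ A') then D x y else 0).rank : ℤ))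

omit [Fintype ι] [DecidableEq ι] [DecidableEq ι'] in
/-- The generic rectangle at `(A^s, A'^t)` (complements taken when the sign is `false`) is the tree's `rect … s t`. -/
theorem rank_Rm_eq_rank_rect (D : Matrix ι ι' K) (A : Finset (Fin n → Bool)) (A' : Finset (Fin n' → Bool)) :
    (Rm (fun x => colourI (row x)) (fun x => colourJ (row x)) (fun y => colourI (col y)) (fun y => colourJ (col y)) D A A').rank
        = (rect row col A A' true true D).rank ∧
    (Rm (fun x => colourI (row x)) (fun x => colourJ (row x)) (fun y => colourI (col y)) (fun y => colourJ (col y)) D A A'ᶜ).rank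
        = (rect row col A A' true false D).rank ∧
    (Rm (fun x => colourI (row x)) (fun x => colourJ (row x)) (fun y => colourI (col y)) (fun y => colourJ (col y)) D Aᶜ A').rank
        = (rect row col A A' false true D).rank ∧
    (Rm (fun x => colourI (row x)) (fun x => colourJ (row x)) (fun y => colourI (col y)) (fun y => colourJ (col y)) D Aᶜ A'ᶜ).rank
        = (rect row col A A' false false D).rank := by
  refine ⟨?_, ?_, ?_, ?_⟩ <;>
  · congr 1
    ext x y
    simp only [Rm, rect_apply, Matrix.of_apply, Finset.mem_compl]
    by_cases h1 : colourI (row x) ∈ A <;> by_cases h2 : colourJ (row x) ∈ A' <;>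
      by_cases h3 : colourI (col y) ∈ A <;> by_cases h4 : colourJ (col y) ∈ A' <;> simp [h1, h2, h3, h4]

include hBC hBA in
/-- **THE 2D MAX-CUT DECOMPOSITION WITH THE ABSOLUTE CONSTANT 4** (registered tool stub `stub_doubleMaxCutDecomposition` with `λ = 4`), from the two
registered TRUE stubs X1 (band completion) and X2 (band averaging). -/
theorem doubleMaxCut_four (n n' : ℕ) :
    DoubleMaxCutDecomposition K n n' 4 := by
  intro ι ι' _ _ _ _ row col D c hc
  classical
  set rI : ι → (Fin n → Bool) := fun x => colourI (row x)
  set rJ : ι → (Fin n' → Bool) := fun x => colourJ (row x)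
  set cI : ι' → (Fin n → Bool) := fun y => colourI (col y)
  set cJ : ι' → (Fin n' → Bool) := fun y => colourJ (col y)
  have hc' : ∀ A A', (Rm rI rJ cI cJ D A A').rank + (Rm rI rJ cI cJ D A A'ᶜ).rank +
      ((Rm rI rJ cI cJ D Aᶜ A').rank + (Rm rI rJ cI cJ D Aᶜ A'ᶜ).rank) ≤ c := by
    intro A A'
    obtain ⟨e1, e2, e3, e4⟩ := rank_Rm_eq_rank_rect row col D A A'
    have h := hc A A'
    rw [doubleCut_eq_sum_four] at h
    simpa only [rI, rJ, cI, cJ, e1, e2, e3, e4] using h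
  obtain ⟨L, hL, hr⟩ := exists_completion_le rI rJ cI cJ D hBC hBA c hc'
  refine ⟨Matrix.of fun x y => if colourI (row x) = colourI (col y) then D x y - L x y else 0,
    Matrix.of fun x y => if colourI (row x) ≠ colourI (col y) ∧ colourJ (row x) = colourJ (col y) then D x y - L x y else 0,
    ?_, ?_, ?_⟩
  · intro x y ⟨k, hk⟩
    have hne : colourI (row x) ≠ colourI (col y) := fun h => hk (by simpa using congrFun h k)
    simp [hne]
  · intro x y ⟨k, hk⟩
    have hne : colourJ (row x) ≠ colourJ (col y) := fun h => hk (by simpa using congrFun h k)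
    simp [hne]
  · have hDL : D - (Matrix.of fun x y => if colourI (row x) = colourI (col y) then D x y - L x y else 0) -
        (Matrix.of fun x y => if colourI (row x) ≠ colourI (col y) ∧ colourJ (row x) = colourJ (col y) then D x y - L x y else 0) = L := by
      ext x y
      simp only [Matrix.sub_apply, Matrix.of_apply]
      by_cases h1 : colourI (row x) = colourI (col y)
      · simp [h1]
      · by_cases h2 : colourJ (row x) = colourJ (col y)
        · simp [h1, h2]
        · have := hL x y h1 h2
          simp [h1, h2, this]
    rw [hDL]
    exact hr

include hBC hBA in
/-- **MERGE with the absolute constant** (the registered `stub_merge` asks for `∃ L₁ e, ∀ K n n', MergeBound K n n' (L₁ (n+n'+2)^e)`; here `L₁ = 4`, `e = 0`),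
from X1 and X2 via `merge_of_doubleMaxCut`. -/
theorem merge_four :
    ∃ L₁ e : ℕ, ∀ (K : Type) [Field K] (n n' : ℕ), MergeBound K n n' (L₁ * (n + n' + 2) ^ e) := by
  refine ⟨4, 0, fun K _ n n' => ?_⟩
  simpa using merge_of_doubleMaxCut (doubleMaxCut_four (K := K) hBC hBA n (n' + 1))

include hBC hBA in
/-- **The registered polynomial-constant form** `∃ L e, ∀ K n n', DoubleMaxCutDecomposition K n n' (L (n+n'+1)^e)` with `L = 4`, `e = 0`. -/
theorem doubleMaxCutDecomposition_four :
    ∃ L e : ℕ, ∀ (K : Type) [Field K] (n n' : ℕ), DoubleMaxCutDecomposition K n n' (L * (n + n' + 1) ^ e) := by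
  refine ⟨4, 0, fun K _ n n' => ?_⟩
  simpa using doubleMaxCut_four (K := K) hBC hBA n n'

end TwoFamily

end Summit.PneNP.PneNP.Theorems.CnfIdealGenLengthRankDefectRepresentationsDoubleMaxCutFour
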